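import Summits.BirchSwinnertonDyer.Rank1Residual.Additive.LocIrrOfGoodSupersingular
import Summits.BirchSwinnertonDyer.Rank1Residual.Additive.GordTwistOrdinary
import Literature.NumberTheory.EllipticCurves.LocalKummerIsotropyTransport
import Literature.NumberTheory.EllipticCurves.OpenImageMazurTwistProofs
import Literature.NumberTheory.EllipticCurves.OpenImageMazurAssemblyProofs
import Literature.NumberTheory.EllipticCurves.QuadraticTwistPadicReduction
import HarnessLib

/-!
# `LocIrr` on the O5 cell `(G) ∧ ss` at `p ≥ 5` (quadratic twists of good supersingular curves), and
# T-O5-CS from Kraus's fact ALONE (cell `b2b-bsdres`, lane CLASS-CLOSURE, class O5; harvest seat 2,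
# GEN 47, E101, part 2/2)

HONEST FRAMING (cell `b2b-bsdres`, run/shared/lean/b2b/bsd-rank1-residual/, verbatim in every
file): the goal of the cell is to DELETE the COMBINATION-SHAPED residual classes of the
Birch–Swinnerton-Dyer formula for ALL analytic-rank `≤ 1` elliptic curves over `ℚ` — "full BSD
formula for every rank `≤ 1` curve in class `C`" assembled STRICTLY from published theorems — so
that the rank-`≤ 1` remainder becomes exactly the CONSTRUCTION-SHAPED classes, which are TYPED
(missing-input `Prop`s), NOT attempted. This is not "finishing BSD". Lane CLASS-CLOSURE: research
routes; no claim beyond the stated classes; nothing is booked here; no mark of `RESIDUAL-MAP.md`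
moves. THEOREMS ONLY (no definition, no named fact, no conjecture node; net named-fact debt `0`).

## What this file does

Part 1/2 (`Additive/LocIrrOfGoodSupersingular.lean`) proved Serre 1972 §1.11 Prop. 12 in local
form: at an odd prime of good supersingular reduction `E[p]|G_{ℚ_p}` is irreducible
(`locIrr_of_dvd_frobeniusTrace`). Here:

* §1 `hasIrreducibleModPGaloisRep_iff_of_signEquivariant` — irreducibility of `E[p]` as a
  `Γ_F`-module passes along an additive isomorphism `V[p] ≃+ V'[p]` commuting with each `σ ∈ Γ_F`
  UP TO SIGN (a stable subgroup is closed under negation). [folklore]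
* §2 `hasIrreducibleModPGaloisRep_quadraticTwist_iff` — **irreducibility of `ρ̄_{E,p}` is invariant
  under quadratic twist** (any field with `2 ≠ 0`: the tree's `E^{(d)}(F̄) ≃+ E(F̄)`, equivariant up to
  the sign `σ√d/√d`, `exists_addEquiv_geomPoints_quadraticTwist_signed`, Silverman *AEC* X.5 Cor. 5.4);
  for `W/ℚ`: `locIrr_quadraticTwist_iff` (base change commutes with the twist, `map_quadraticTwist`)
  and `locIrr_smul_iff` (change of model, `Mazur1978.hasIrreducibleModPGaloisRep_smul_iff`; the `p = 3`
  instances `locIrr_three_iff_of_twist'`, `locIrr_three_smul_iff` exist).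
* §3 **`locIrr_of_subGss`** — `5 ≤ p → Addv W p → SubGss W p → LocIrr W p`: the cell is `I₀*`
  (`SubGss.subGordTwo`: `e = 2`, `ord_p j ≥ 0`); a globally minimal model `Wd` of `E^{(p*)}`,
  `p* = (−1)^{(p−1)/2} p` (Néron, `hasGlobalMinimalModel_rat_holds`), has GOOD reduction at `p`
  (`hasGoodReductionAtPrime_twist_pStar`) and is NOT ordinary, `W` not being (G)-ordinary
  (`typeGOrd_iff_goodOrd_twist_pStar`); so `p ∣ a_p(Wd)`, `LocIrr Wd p` by part 1, and `LocIrr W p`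
  by §2. **`locIrrTameIffNoCanonicalSubgroup_of_kraus`** — the node T-O5-CS
  `LocIrrTameIffNoCanonicalSubgroup` granted ONLY `Kraus1997.propTwo_pTorsion_of_supersingular`
  (GEN 46's `locIrrTameIffNoCanonicalSubgroup_of_kraus_of_subGss`, binder `hss` DISCHARGED);
  `locIrr_and_not_canonicalSubgroupCriterion_of_subGss` — the `(G) ∧ ss` row unconditionally;
  `locIrr_iff_not_canonicalSubgroupCriterion_of_classO5` — pointwise form.

So on the census cell `(G) ∧ ss` of O5 at `p ≥ 5` (rmap-2 S-b: 770 X4 pairs; 739 rows in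
LOCRED5-2ENG v1, all NOCANON) the Fouquet–Wan (Lgl) bit `LocIrr` is a THEOREM of the tree, and on
`(t′)` it is Kraus 1997 Prop. 2 read through one cited fact (GEN 46). Nothing booked; no mark moves;
O5 stays OPEN (this is the hypothesis bit of an announced proof, not a `p`-part statement); the
node's attribute is its typer's pen (cc-typer-5).

References: J.-P. Serre, Invent. Math. 15 (1972), §1.11 Prop. 12 [Serre1972]; J. H. Silverman, *AEC*
(2009), X.2 Prop. 2.4, X.5 Cor. 5.4 [SilvermanAEC2009]; A. Kraus, Dissertationes Math. 364 (1997),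
Prop. 2, Lemmes 1–2 [Kraus1997Dissertationes]; cell: HOME/b2b-bsdres-harvest-2/gen46/E100 §5 (α),
gen47/E101.
-/

set_option autoImplicit false

noncomputable section

open scoped Classical

open WeierstrassCurve Literature.NumberTheory.EllipticCurves
  Literature.NumberTheory.EllipticCurves.Rank1Residual
  Literature.NumberTheory.EllipticCurves.Kraus1997 Field

namespace Summit.BirchSwinnertonDyer.Rank1Residual.Additive

/-! ## §1 Irreducibility passes along isomorphisms that are equivariant up to sign -/

section SignTransport

variable {F : Type*} [Field F] {V V' : WeierstrassCurve F} {p : ℕ}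

/-- **Irreducibility passes along an additive isomorphism that commutes with `Γ_F` up to sign**:
if `f : V[p] ≃+ V'[p]` satisfies, for each `σ`, `f(σP) = σ f(P)` for all `P` or `f(σP) = −σ f(P)`
for all `P`, and `V[p]` is irreducible, so is `V'[p]` (the preimage of a stable subgroup is stable,
a subgroup being closed under negation). [folklore] -/
theorem hasIrreducibleModPGaloisRep_of_signEquivariant
    (f : geomTorsion V (p : ℤ) ≃+ geomTorsion V' (p : ℤ))
    (hf : ∀ σ : absoluteGaloisGroup F,
      (∀ P, f (σ • P) = σ • f P) ∨ (∀ P, f (σ • P) = -(σ • f P)))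
    (h : V.HasIrreducibleModPGaloisRep p) : V'.HasIrreducibleModPGaloisRep p := by
  intro H hH
  have hstab : ∀ (σ : absoluteGaloisGroup F), ∀ P ∈ H.comap f.toAddMonoidHom,
      σ • P ∈ H.comap f.toAddMonoidHom := fun σ P hP ↦ by
    rw [AddSubgroup.mem_comap] at hP ⊢
    change f P ∈ H at hP
    change f (σ • P) ∈ H
    rcases hf σ with hσ | hσ
    · rw [hσ]; exact hH σ _ hP
    · rw [hσ]; exact H.neg_mem (hH σ _ hP)
  rcases h (H.comap f.toAddMonoidHom) hstab with hbot | htop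
  · left
    rw [eq_bot_iff]
    intro Q hQ
    have hQ' : f.symm Q ∈ H.comap f.toAddMonoidHom := by
      rw [AddSubgroup.mem_comap]
      change f (f.symm Q) ∈ H
      rwa [f.apply_symm_apply]
    rw [hbot, AddSubgroup.mem_bot] at hQ'
    rw [AddSubgroup.mem_bot, ← f.apply_symm_apply Q, hQ', map_zero]
  · right
    rw [eq_top_iff]
    intro Q _
    have hQ' : f.symm Q ∈ H.comap f.toAddMonoidHom := by rw [htop]; exact AddSubgroup.mem_top _
    rw [AddSubgroup.mem_comap] at hQ'
    change f (f.symm Q) ∈ H at hQ'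
    rwa [f.apply_symm_apply] at hQ'

/-- The inverse of a sign-equivariant isomorphism is sign-equivariant. [folklore] -/
theorem addEquiv_symm_signEquivariant
    (f : geomTorsion V (p : ℤ) ≃+ geomTorsion V' (p : ℤ))
    (hf : ∀ σ : absoluteGaloisGroup F,
      (∀ P, f (σ • P) = σ • f P) ∨ (∀ P, f (σ • P) = -(σ • f P)))
    (σ : absoluteGaloisGroup F) :
    (∀ Q, f.symm (σ • Q) = σ • f.symm Q) ∨ (∀ Q, f.symm (σ • Q) = -(σ • f.symm Q)) := by
  rcases hf σ with hσ | hσ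
  · exact Or.inl fun Q ↦ f.injective (by rw [f.apply_symm_apply, hσ, f.apply_symm_apply])
  · exact Or.inr fun Q ↦ f.injective (by
      rw [f.apply_symm_apply, map_neg, hσ, f.apply_symm_apply, neg_neg])

/-- **Irreducibility of `E[p]` is invariant under a sign-equivariant isomorphism `V[p] ≃+ V'[p]`.**
[folklore] -/
theorem hasIrreducibleModPGaloisRep_iff_of_signEquivariant
    (f : geomTorsion V (p : ℤ) ≃+ geomTorsion V' (p : ℤ))
    (hf : ∀ σ : absoluteGaloisGroup F,
      (∀ P, f (σ • P) = σ • f P) ∨ (∀ P, f (σ • P) = -(σ • f P))) :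
    V.HasIrreducibleModPGaloisRep p ↔ V'.HasIrreducibleModPGaloisRep p :=
  ⟨hasIrreducibleModPGaloisRep_of_signEquivariant f hf,
    hasIrreducibleModPGaloisRep_of_signEquivariant f.symm (addEquiv_symm_signEquivariant f hf)⟩

end SignTransport

/-! ## §2 Quadratic twists and changes of model do not change `LocIrr` -/

section Twist

/-- **Irreducibility of `ρ̄_{E,p}` is a quadratic-twist invariant** (any field `F` with `2 ≠ 0`, any
`d ≠ 0`, any `p`): `E^{(d)}[p]` is an irreducible `Γ_F`-module iff `E[p]` is. The tree's isomorphism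
`E^{(d)}(F̄) ≃+ E(F̄)` (`exists_addEquiv_geomPoints_quadraticTwist_signed`) commutes with each
`σ ∈ Γ_F` up to the sign `σ√d/√d`; restrict it to the `p`-torsion (`torsionByCongr`) and apply §1.
[cite: SilvermanAEC2009, X.5 Cor. 5.4 and X.2 Prop. 2.4] -/
theorem hasIrreducibleModPGaloisRep_quadraticTwist_iff {F : Type*} [Field F] [NeZero (2 : F)]
    (V : WeierstrassCurve F) {d : F} (hd : d ≠ 0) (p : ℕ) :
    (V.quadraticTwist d).HasIrreducibleModPGaloisRep p ↔ V.HasIrreducibleModPGaloisRep p := by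
  obtain ⟨f, hf⟩ := V.exists_addEquiv_geomPoints_quadraticTwist_signed hd
  refine hasIrreducibleModPGaloisRep_iff_of_signEquivariant (torsionByCongr f (p : ℤ)) fun σ ↦ ?_
  rcases hf σ with h | h
  · refine Or.inl fun P ↦ Subtype.ext ?_
    simp only [coe_torsionByCongr_apply, AddSubgroup.torsionBy.coe_smul, h]
  · refine Or.inr fun P ↦ Subtype.ext ?_
    simp only [coe_torsionByCongr_apply, AddSubgroup.torsionBy.coe_smul, h, NegMemClass.coe_neg]

variable (W : WeierstrassCurve ℚ) (p : ℕ) [Fact p.Prime]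

/-- **`LocIrr` is a property of the curve, not of the model**: a change of Weierstrass equation over
`ℚ` induces one over `ℚ_p`, under which irreducibility of `E[p]|G_{ℚ_p}` is invariant
(`Mazur1978.hasIrreducibleModPGaloisRep_smul_iff`; the `p = 3` instance is `locIrr_three_smul_iff`).
[folklore] -/
theorem locIrr_smul_iff (C : VariableChange ℚ) : LocIrr (C • W) p ↔ LocIrr W p := by
  unfold LocIrr
  rw [WeierstrassCurve.baseChange, WeierstrassCurve.baseChange, ← map_variableChange]
  exact Mazur1978.hasIrreducibleModPGaloisRep_smul_iff _ _ p

/-- **`LocIrr` is a quadratic-twist invariant**: `LocIrr (W^{(d)}) p ↔ LocIrr W p` for `d ≠ 0`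
(base change to `ℚ_p` commutes with the twist, `map_quadraticTwist`, then
`hasIrreducibleModPGaloisRep_quadraticTwist_iff` over `ℚ_p`; the `p = 3` instance is
`locIrr_three_iff_of_twist'`). [cite: SilvermanAEC2009, X.5 Cor. 5.4] -/
theorem locIrr_quadraticTwist_iff {d : ℚ} (hd : d ≠ 0) : LocIrr (W.quadraticTwist d) p ↔ LocIrr W p := by
  unfold LocIrr
  rw [WeierstrassCurve.baseChange, WeierstrassCurve.baseChange, map_quadraticTwist]
  haveI : NeZero (2 : ℚ_[p]) := ⟨two_ne_zero⟩
  exact hasIrreducibleModPGaloisRep_quadraticTwist_iff _ ((map_ne_zero _).mpr hd) p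

end Twist

/-! ## §3 The O5 cell `(G) ∧ ss` at `p ≥ 5`, and T-O5-CS from Kraus's fact alone -/

section SubGss

variable (W : WeierstrassCurve ℚ) [W.IsElliptic] [W.IsGloballyMinimal] (p : ℕ) [hp : Fact p.Prime]

/-- **On `(G) ∧ ss` at `p ≥ 5`, `E[p]|G_{ℚ_p}` is irreducible**: `5 ≤ p → Addv W p → SubGss W p →
LocIrr W p`. The cell is Kodaira `I₀*` (`SubGss.subGordTwo`: `e = 2`, `ord_p j ≥ 0`); a globally
minimal model `Wd` of the twist `E^{(p*)}`, `p* = (−1)^{(p−1)/2} p` (Néron, `hasGlobalMinimalModel_rat_holds`)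
has GOOD reduction at `p` (`hasGoodReductionAtPrime_twist_pStar`) and is NOT ordinary there, since
`W` is not (G)-ordinary (`typeGOrd_iff_goodOrd_twist_pStar`); so `p ∣ a_p(Wd)`, `LocIrr Wd p` by Serre's
Prop. 12 (`locIrr_of_dvd_frobeniusTrace`), and `LocIrr W p` by twist and model invariance (§2).
[cite: Serre1972, §1.11 Prop. 12] [cite: SilvermanAEC2009, X.5 Cor. 5.4] -/
theorem locIrr_of_subGss (hp5 : 5 ≤ p) (hadd : Addv W p) (hG : SubGss W p) : LocIrr W p := by
  have hp2 : p ≠ 2 := by omega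
  obtain ⟨⟨hnot, -, -⟩, he⟩ := SubGss.subGordTwo W p hp2 hadd hG
  have hj : 0 ≤ padicValRat p W.j := not_lt.mp hnot
  -- a globally minimal model of the twist by `p*`
  set d : ℚ := (-1 : ℚ) ^ (p / 2) * p with hddef
  have hd0 : d ≠ 0 :=
    mul_ne_zero (pow_ne_zero _ (by norm_num)) (by exact_mod_cast hp.out.ne_zero)
  haveI : NeZero (2 : ℚ) := ⟨two_ne_zero⟩
  haveI : (W.quadraticTwist d).IsElliptic := W.isElliptic_quadraticTwist hd0
  obtain ⟨C, hC⟩ := hasGlobalMinimalModel_rat_holds (W.quadraticTwist d)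
  haveI := hC
  -- good and supersingular at `p`
  have hgood : (C • W.quadraticTwist d).HasGoodReductionAtPrime p :=
    hasGoodReductionAtPrime_twist_pStar W p hp5 hj ((semistabilityIndex_eq_two_iff W p).mp he)
      (C • W.quadraticTwist d) C rfl
  have hss : (p : ℤ) ∣ (C • W.quadraticTwist d).frobeniusTrace p := by
    by_contra hunit
    exact hG.2 ((typeGOrd_iff_goodOrd_twist_pStar W p hp5 he (C • W.quadraticTwist d) C rfl).mpr
      ⟨hgood, hunit⟩)
  have hV : LocIrr (C • W.quadraticTwist d) p :=
    locIrr_of_dvd_frobeniusTrace (C • W.quadraticTwist d) p hp2 hgood hss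
  rwa [locIrr_smul_iff, locIrr_quadraticTwist_iff W p hd0] at hV

/-- **The `(G) ∧ ss` row of T-O5-CS, unconditionally** (`p ≥ 5`): `LocIrr W p` holds and the
canonical-subgroup criterion fails (`v_p(Δ_min) = 6`, GEN 46's `not_canonicalSubgroupCriterion_of_subGss`).
[cite: Serre1972, §1.11 Prop. 12] [cite: Kraus1997Dissertationes, Lemme 2 (p. 10), case v(Δ) = 6] -/
theorem locIrr_and_not_canonicalSubgroupCriterion_of_subGss (hp5 : 5 ≤ p) (hadd : Addv W p)
    (hG : SubGss W p) : LocIrr W p ∧ ¬ CanonicalSubgroupCriterion p W :=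
  ⟨locIrr_of_subGss W p hp5 hadd hG, not_canonicalSubgroupCriterion_of_subGss W p hp5 hadd hG⟩

/-- **T-O5-CS from Kraus's published theorem ALONE.** Granted the Literature fact
`Kraus1997.propTwo_pTorsion_of_supersingular` (Kraus 1997 Prop. 2 with Lemmes 1–2, p307235), the
node `LocIrrTameIffNoCanonicalSubgroup` holds: GEN 46's `locIrrTameIffNoCanonicalSubgroup_of_kraus_of_subGss`
with its classical binder `hss` DISCHARGED by `locIrr_of_subGss`.
[cite: Kraus1997Dissertationes, Prop. 2 (p. 10), Lemme 1 (p. 8), Lemme 2 (p. 10)]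
[cite: Serre1972, §1.11 Prop. 12] -/
theorem locIrrTameIffNoCanonicalSubgroup_of_kraus (hK : propTwo_pTorsion_of_supersingular) :
    LocIrrTameIffNoCanonicalSubgroup :=
  locIrrTameIffNoCanonicalSubgroup_of_kraus_of_subGss hK
    fun p _ hp5 W _ _ hadd hG ↦ locIrr_of_subGss W p hp5 hadd hG

/-- **T-O5-CS pointwise, from Kraus's fact**: for `p ≥ 5` and `W` in class O5 at `p`,
`LocIrr W p ↔ ¬ CanonicalSubgroupCriterion p W`. [cite: Kraus1997Dissertationes, Prop. 2 (p. 10)]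
[cite: Serre1972, §1.11 Prop. 12] -/
theorem locIrr_iff_not_canonicalSubgroupCriterion_of_classO5
    (hK : propTwo_pTorsion_of_supersingular) (hp5 : 5 ≤ p) (hO : ClassO5 W p) :
    LocIrr W p ↔ ¬ CanonicalSubgroupCriterion p W :=
  locIrrTameIffNoCanonicalSubgroup_of_kraus hK p hp5 W hO

end SubGss

end Summit.BirchSwinnertonDyer.Rank1Residual.Additive

end
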